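import Summits.ABC.IUTFork.Joshi.GeometricCase2AsPrintedDichotomy
import Summits.ABC.IUTFork.Joshi.GeometricCaseCoverModelDisplacement

/-!
# Joshi's geometric case — the verbatim Thm. 12.18.1 on the HONEST universal cover `S̃L₂(ℝ)` (arXiv:2401.13508 v4, §12.18)
# proof-only record, no new definitions

Record file of the abc-iut cell, branch E (rung LADDER-ABC:A2.E; seat abc-iut-E-t53, §12 lineage). The model-free dichotomy of
`Joshi/GeometricCase2AsPrintedDichotomy.lean` (`HeightDatum.thm12181AsPrinted_iff_degenerate`: under (12.14.1) ∧ (12.15.1)-as-typed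
and `S ≠ ∅`, the sentence displayed as Thm. 12.18.1 holds iff `Θ_classical(D) = ∅` or `|Θ_classical(D)| = +∞`) is instantiated at the
honest universal cover — the automorphy-factor model `Geo.coverModel` of `S̃L₂(ℝ)` (`Joshi/GeometricCaseCoverModel.lean`) with the
Zhang/ABKP DISPLACEMENT height `Geo.CoverModel.displacementHeightDatum` (`Joshi/GeometricCaseCoverModelDisplacement.lean`), where
(12.14.1) and (12.15.1)-as-typed are THEOREMS (`heightSubadditive_displacement`, `heightLogLinkBound_displacement`). So on the intended
structure (not a toy carrier) the dichotomy is UNCONDITIONAL: for every level `ℓ`, every `S ≠ ∅`, every domain locus and every monodromy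
datum the verbatim sentence is equivalent to degeneracy of the locus, and fails for every finite non-empty locus. OUR READING
(`Thm12181Reading`) holds there for every locus (`thm12181Reading_displacement`). Located, not adjudicated; a kernel sentence about OUR
TYPING of an unrefereed preprint (bib `Joshi2024ATS3`, disputed in print: `Mochizuki2024JoshiReport`); nothing is asserted about
[IUTchIII] Cor. 3.12, about abc, or about any author. [claim: Joshi2024ATS3, status: disputed]
-/

noncomputable section

namespace Summit.ABC.IUTFork.Joshi.ATS3.Geo.CoverModel

/-- On the honest `S̃L₂(ℝ)` (model `Geo.coverModel`) with the DISPLACEMENT height — where (12.14.1) and (12.15.1)-as-typed are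
theorems — the verbatim Thm. 12.18.1 is equivalent, for every level `ℓ`, every `S ≠ ∅`, every domain locus and every monodromy
datum, to degeneracy of the locus: `Θ_classical(D) = ∅` or `|Θ_classical(D)| = +∞`. [folklore] -/
theorem thm12181AsPrinted_displacement_iff (L : Level) {Pi : Type} [Group Pi] {genus n : ℕ} (hn : 0 < n)
    (D : (displacementHeightDatum L).DomainLocus n) (M : GeoLocus.MonodromyDatum Pi genus n) :
    (displacementHeightDatum L).Thm12181AsPrinted D M ↔ (D.carrier = ∅ ∨ D.size = ⊤) :=
  (displacementHeightDatum L).thm12181AsPrinted_iff_degenerate (heightSubadditive_displacement L)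
    (heightLogLinkBound_displacement L) hn D M

/-- In particular no FINITE non-empty locus over the honest `S̃L₂(ℝ)` with the displacement height satisfies the verbatim
Thm. 12.18.1 (`S ≠ ∅`; any level, any monodromy datum — irreducibility of `ρ_ℓ` plays no role). [folklore] -/
theorem not_thm12181AsPrinted_displacement_of_finite (L : Level) {Pi : Type} [Group Pi] {genus n : ℕ} (hn : 0 < n)
    (D : (displacementHeightDatum L).DomainLocus n) (M : GeoLocus.MonodromyDatum Pi genus n) (hne : D.carrier.Nonempty)
    (hfin : D.carrier.Finite) : ¬ (displacementHeightDatum L).Thm12181AsPrinted D M :=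
  (displacementHeightDatum L).not_thm12181AsPrinted_of_finite (heightLogLinkBound_displacement L) hn D M hne hfin

/-- … while OUR READING of Thm. 12.18.1 holds there for every domain locus and every monodromy datum (`S ≠ ∅`), and the sums
`∑ h` over lift families are unbounded above: for every real `r` some family of lifts has `∑_{s,j} h(γ̃_s^{(j)}) > r`. [folklore] -/
theorem reading_and_unbounded_lifts_displacement (L : Level) {Pi : Type} [Group Pi] {genus n : ℕ} (hn : 0 < n)
    (D : (displacementHeightDatum L).DomainLocus n) (M : GeoLocus.MonodromyDatum Pi genus n) (r : ℝ) :
    (displacementHeightDatum L).Thm12181Reading D M ∧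
      ∃ γt : Fin n → Fin L.lstar → Cover, M.IsLiftFamily (displacementHeightDatum L) γt ∧
        r < (displacementHeightDatum L).hSum γt :=
  ⟨thm12181Reading_displacement L hn D M,
    (displacementHeightDatum L).exists_isLiftFamily_lt_hSum (heightLogLinkBound_displacement L) hn M r⟩

end Summit.ABC.IUTFork.Joshi.ATS3.Geo.CoverModel

end
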